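import Mathlib
import Summits.AtomisticToContinuum.HydrodynamicLimit.Theorems.ImplosionDichotomyDenseExcursionSonicCavityDefs

/-!
# Flat functions and the singular Grönwall lemma at a regular singular point
# (crux `DenseExcursion`, line `sonic-cavity-renewal`, bricks for stub `stub_sonicConfinement`)

Helper file (`--supports stmt-AtomisticToContinuum-12586`, line lead a2, stub-worker for `stub_sonicConfinement`).

Three generic real-analysis facts used to continue a smooth radial mode uniquely THROUGH the sonic point `x = 0`, where
the mode ODE `v′ = A⁻¹(Λ − B)v` has a regular singular point (`‖A⁻¹(Λ − B)‖ ≤ C/x` on `0 < x ≤ 1` by the chord bound of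
`CavityTube` (a)):

* `iteratedDeriv_eq_zero_of_eqOn_neg`: a `C^∞` function vanishing on `x < 0` has all derivatives `0` at `0`;
* `norm_le_pow_of_iteratedDeriv_eq_zero`: a `C^∞` function with vanishing `n`-jet at `0` is `O(x^{n+1})` on `[0, b]` (Taylor);
* `eq_zero_of_flat_of_norm_deriv_le` (registered helper, the SINGULAR GRÖNWALL LEMMA): if `‖v′‖ ≤ (C/x)‖v‖` on `(0, b]`,
  `b ≤ 1`, and `‖v x‖ ≤ M xⁿ` with `n ≥ C + 1`, then `v ≡ 0` on `(0, b]` — Grönwall in logarithmic time `s = log x`, where the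
  equation has the BOUNDED coefficient `C`, gives `‖v x′‖ ≤ ‖v x‖ (x′/x)^C ≤ M x′^C x → 0` as `x → 0⁺`.
  (The Frobenius picture: the solutions at a regular singular point grow at most like `x^{−C}`, so a solution vanishing to
  order `> C` is zero; no analyticity is used.)

NOT here: the mode-specific continuation theorem (`…SonicConfinementContinuation`).
-/

noncomputable section

open Set Filter
open scoped Topology ContDiff

namespace Summit.AtomisticToContinuum.HydrodynamicLimit.Theorems.SonicCavityRenewal

/-- A `C^∞` function `ℝ → ℂ` that vanishes on `x < 0` has all its derivatives equal to `0` at `0` (they vanish on the open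
set `x < 0` and are continuous). [folklore] -/
theorem iteratedDeriv_eq_zero_of_eqOn_neg {f : ℝ → ℂ} (hf : ContDiff ℝ ∞ f) (h0 : ∀ x, x < 0 → f x = 0) (k : ℕ) :
    iteratedDeriv k f 0 = 0 := by
  have h1 : EqOn (iteratedDeriv k f) (iteratedDeriv k fun _ : ℝ => (0 : ℂ)) (Iio 0) :=
    EqOn.iteratedDeriv_of_isOpen (fun x hx => h0 x hx) isOpen_Iio k
  have h2 : ∀ x, x < 0 → iteratedDeriv k f x = 0 := fun x hx => by
    rw [h1 hx, iteratedDeriv_fun_const_zero]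
  have hc : Continuous (iteratedDeriv k f) := hf.continuous_iteratedDeriv k (by exact_mod_cast le_top)
  have t1 : Tendsto (iteratedDeriv k f) (𝓝[<] (0 : ℝ)) (𝓝 (iteratedDeriv k f 0)) :=
    hc.continuousAt.tendsto.mono_left nhdsWithin_le_nhds
  have t2 : Tendsto (iteratedDeriv k f) (𝓝[<] (0 : ℝ)) (𝓝 0) :=
    tendsto_const_nhds.congr' (eventually_nhdsWithin_of_forall fun x hx => (h2 x hx).symm)
  exact tendsto_nhds_unique t1 t2

/-- TAYLOR: a `C^∞` function `ℝ → ℂ` whose derivatives of order `≤ n` vanish at `0` satisfies `‖f x‖ ≤ M x^{n+1}` on `[0, b]`.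
[folklore] -/
theorem norm_le_pow_of_iteratedDeriv_eq_zero {f : ℝ → ℂ} {n : ℕ} {b : ℝ} (hb : 0 < b) (hf : ContDiff ℝ ∞ f)
    (h0 : ∀ k, k ≤ n → iteratedDeriv k f 0 = 0) : ∃ M : ℝ, ∀ x ∈ Icc 0 b, ‖f x‖ ≤ M * x ^ (n + 1) := by
  have hf' : ContDiffOn ℝ (n + 1) f (Icc 0 b) := (hf.of_le (by exact_mod_cast le_top)).contDiffOn
  have hu : UniqueDiffOn ℝ (Icc 0 b) := uniqueDiffOn_Icc hb
  have hcont : ContinuousOn (fun y => iteratedDerivWithin (n + 1) f (Icc 0 b) y) (Icc 0 b) :=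
    hf'.continuousOn_iteratedDerivWithin le_rfl hu
  obtain ⟨C, hC⟩ := isCompact_Icc.exists_bound_of_continuousOn hcont
  refine ⟨C / n.factorial, fun x hx => ?_⟩
  have hT : taylorWithinEval f n (Icc 0 b) 0 x = 0 := by
    rw [taylor_within_apply]
    refine Finset.sum_eq_zero fun k hk => ?_
    have hk' : k ≤ n := Nat.lt_succ_iff.1 (Finset.mem_range.1 hk)
    rw [iteratedDerivWithin_eq_iteratedDeriv hu (hf.contDiffAt.of_le (by exact_mod_cast le_top))
      (left_mem_Icc.2 hb.le), h0 k hk', smul_zero]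
  have h := taylor_mean_remainder_bound hb.le hf' hx hC
  rw [hT, sub_zero, sub_zero] at h
  calc ‖f x‖ ≤ C * x ^ (n + 1) / n.factorial := h
    _ = C / n.factorial * x ^ (n + 1) := by ring

/-- **THE SINGULAR GRÖNWALL LEMMA** — registered helper `eq_zero_of_flat_of_norm_deriv_le` for `stub_sonicConfinement`.
Let `v : ℝ → E` satisfy `‖v′ x‖ ≤ (C/x) ‖v x‖` on `(0, b]`, `b ≤ 1`, `0 ≤ C`, and the flatness bound `‖v x‖ ≤ M xⁿ` there with
`C + 1 ≤ n`. Then `v ≡ 0` on `(0, b]`: in logarithmic time `s = log x` the function `g s = v (eˢ)` has `‖g′‖ ≤ C ‖g‖`, so Grönwall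
gives `‖v x′‖ ≤ ‖v x‖ e^{C (log x′ − log x)} ≤ M e^{C log x′} e^{(n − C) log x} ≤ M e^{C log x′}·x` for `0 < x ≤ x′`, and `x → 0⁺`.
[folklore] -/
theorem eq_zero_of_flat_of_norm_deriv_le : ∀ (v v' : ℝ → ℂ × ℂ) (b C M : ℝ) (n : ℕ), 0 < b → b ≤ 1 → 0 ≤ C → (∀ x ∈ Set.Ioc 0 b, HasDerivAt v (v' x) x) → (∀ x ∈ Set.Ioc 0 b, ‖v' x‖ ≤ C / x * ‖v x‖) → (∀ x ∈ Set.Ioc 0 b, ‖v x‖ ≤ M * x ^ n) → C + 1 ≤ n → ∀ x ∈ Set.Ioc 0 b, v x = 0 := by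
  intro v v' b C M n hb hb1 hC hv hbound hflat hn x' hx'
  have hM : 0 ≤ M := by
    have h := hflat b ⟨hb, le_rfl⟩
    have hbn : 0 < b ^ n := pow_pos hb n
    nlinarith [norm_nonneg (v b)]
  -- the key estimate: `‖v x'‖ ≤ (M e^{C log x'}) · x` for every `0 < x ≤ x'`
  have key : ∀ x ∈ Ioc 0 x', ‖v x'‖ ≤ M * Real.exp (C * Real.log x') * x := by
    intro x hx
    have hx0 : 0 < x := hx.1
    have hxb : ∀ s ∈ Icc (Real.log x) (Real.log x'), Real.exp s ∈ Ioc 0 b := by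
      intro s hs
      refine ⟨Real.exp_pos s, ?_⟩
      calc Real.exp s ≤ Real.exp (Real.log x') := Real.exp_le_exp.2 hs.2
        _ = x' := Real.exp_log hx'.1
        _ ≤ b := hx'.2
    -- Grönwall in logarithmic time
    set g : ℝ → ℂ × ℂ := fun s => v (Real.exp s) with hg
    have hgd : ∀ s ∈ Icc (Real.log x) (Real.log x'),
        HasDerivAt g (Real.exp s • v' (Real.exp s)) s := fun s hs =>
      (hv (Real.exp s) (hxb s hs)).scomp s (Real.hasDerivAt_exp s)
    have hgc : ContinuousOn g (Icc (Real.log x) (Real.log x')) := fun s hs =>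
      (hgd s hs).continuousAt.continuousWithinAt
    have hgb : ∀ s ∈ Ico (Real.log x) (Real.log x'), ‖Real.exp s • v' (Real.exp s)‖ ≤ C * ‖g s‖ + 0 := by
      intro s hs
      have hs' : Real.exp s ∈ Ioc 0 b := hxb s (Ico_subset_Icc_self hs)
      rw [add_zero, norm_smul, Real.norm_of_nonneg (Real.exp_pos s).le]
      calc Real.exp s * ‖v' (Real.exp s)‖ ≤ Real.exp s * (C / Real.exp s * ‖v (Real.exp s)‖) :=
            mul_le_mul_of_nonneg_left (hbound _ hs') (Real.exp_pos s).le
        _ = C * ‖g s‖ := by rw [hg]; field_simp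
    have hG := norm_le_gronwallBound_of_norm_deriv_right_le (f := g) (δ := ‖v x‖) (K := C) (ε := 0)
      (a := Real.log x) (b := Real.log x') hgc (fun s hs => (hgd s (Ico_subset_Icc_self hs)).hasDerivWithinAt)
      (by rw [hg]; simp only [Real.exp_log hx0]; exact le_rfl) hgb (Real.log x')
      (right_mem_Icc.2 (Real.log_le_log hx0 hx.2))
    rw [gronwallBound_ε0] at hG
    have hG' : ‖v x'‖ ≤ ‖v x‖ * Real.exp (C * (Real.log x' - Real.log x)) := by
      simpa only [hg, Real.exp_log hx'.1] using hG
    -- flatness at `x` and exponential bookkeeping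
    have hfx : ‖v x‖ ≤ M * Real.exp (n * Real.log x) := by
      rw [Real.exp_nat_mul, Real.exp_log hx0]
      exact hflat x ⟨hx0, hx.2.trans hx'.2⟩
    have hlogx : Real.log x ≤ 0 := Real.log_nonpos hx0.le (hx.2.trans (hx'.2.trans hb1))
    have hmono : Real.exp ((n - C) * Real.log x) ≤ x := by
      calc Real.exp ((n - C) * Real.log x) ≤ Real.exp (Real.log x) := by
            apply Real.exp_le_exp.2
            nlinarith
        _ = x := Real.exp_log hx0
    calc ‖v x'‖ ≤ ‖v x‖ * Real.exp (C * (Real.log x' - Real.log x)) := hG'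
      _ ≤ M * Real.exp (n * Real.log x) * Real.exp (C * (Real.log x' - Real.log x)) :=
          mul_le_mul_of_nonneg_right hfx (Real.exp_pos _).le
      _ = M * Real.exp (C * Real.log x') * Real.exp ((n - C) * Real.log x) := by
          rw [mul_assoc, mul_assoc, ← Real.exp_add, ← Real.exp_add]
          congr 2
          ring
      _ ≤ M * Real.exp (C * Real.log x') * x :=
          mul_le_mul_of_nonneg_left hmono (by positivity)
  -- let `x → 0⁺`
  have hlim : Tendsto (fun x : ℝ => M * Real.exp (C * Real.log x') * x) (𝓝[>] 0) (𝓝 0) := by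
    have : Tendsto (fun x : ℝ => M * Real.exp (C * Real.log x') * x) (𝓝 0)
        (𝓝 (M * Real.exp (C * Real.log x') * 0)) :=
      (continuous_const.mul continuous_id).tendsto 0
    rw [mul_zero] at this
    exact this.mono_left nhdsWithin_le_nhds
  have hev : ∀ᶠ x in 𝓝[>] (0 : ℝ), ‖v x'‖ ≤ M * Real.exp (C * Real.log x') * x :=
    eventually_of_mem (Ioc_mem_nhdsGT hx'.1) key
  exact norm_le_zero_iff.1 (ge_of_tendsto hlim hev)

end Summit.AtomisticToContinuum.HydrodynamicLimit.Theorems.SonicCavityRenewal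

end
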